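import Literature.Geometry.Lorentzian.KerrNullRadialPotential
import Literature.Geometry.Lorentzian.SpacetimeLocalConvergence
import Literature.Geometry.Lorentzian.CoordScalarCurvatureEvolution
import Literature.Geometry.Lorentzian.KerrSchildCoord
import Literature.Geometry.Lorentzian.SpacetimeMetricInCoordsCalculus
import Literature.Geometry.Lorentzian.CoordScalarJet
import Summits.FinalStateConjecture.FinalStateConjecture.Theorems.BartnikGapSettlingGapExhaustionCylindersBendInwardOf
import HarnessLib

/-!
# `KerrNoncharacteristic`: the glue (P-3) → (P-4) → time-uniform condition (po3.2)
(crux `GapExhaustion`, stmt-FinalStateConjecture-10808, line photon-shell-pseudoconvexity;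
stub (P-5) `stub_kerrNoncharacteristic_of` of the quantitative `T`-conditional pseudo-convexity
bricks for `h = r`, Ionescu–Klainerman, Invent. Math. 175 (2009), Definition 3.1)

Given

* (P-3) the exact-Kerr non-characteristic bounds: on a radial band `r₊ < r_lo ≤ r ≤ r_e` of the
  Kerr–Schild chart, `g⁻¹(dr, dr) = dr(∇r) ≥ ν > 0` and `|Hess r (∇r, ∇r)| ≤ B` for the
  Kerr–Schild components `g_{M,a}` (at all times `x⁰`), and
* (P-4) the generic `C¹`-stability of these two bounds (as `ν/2`, `B + 1`) over a compact set
  under a `δ`-perturbation of the `1`-jet of the components at the point,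

we deduce condition (po3.2) of Ionescu–Klainerman's Definition 3.1,
`(g⁻¹(dr,dr))² − ε Hess r (∇r, ∇r) ≥ ε₁²` for all `0 < ε ≤ ε₁`, uniformly in time, for every
spacetime chart on the exterior region `{M < r}` whose pulled-back components
(`Spacetime.metricInCoords`) are `δ`-close in `C²` sup norm (`supCkENorm`) to `g_{M,a}` on the
band: apply (P-4) on the compact time slice `{x⁰ = 0, r_lo ≤ r ≤ r_e}`
(`kerrCylindersBendInward_isCompact_slice`) with `G₀ = g_{M,a}`, `f = r`, choose `ε₁ > 0` with
`ε₁² + ε₁ (|B| + 1) ≤ ν²/4` (`ε₁ := min (ν/4) (ν²/(8(|B|+1)))`), and transport to arbitrary times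
by the stationarity of Kerr (`Kerr.bilin_add_smul_basisVector_zero`,
`Kerr.radius_add_time_smul_basisVector`) and the naturality of `♯` and of the coordinate Hessian
under translations (`MetricCoord.sharpAt_comp_add_right`,
`kerrCylindersBendInward_hessAt_comp_add_right`, `fderiv_comp_add_right`).
-/

noncomputable section

-- instance search through the nested operator types `E4 →L[ℝ] E4 →L[ℝ] E4 →L[ℝ] ℝ`
set_option maxSynthPendingDepth 3

-- D-0017: single-problem summit, `Summit.<S>.<S>.…` by design (cf. lakefile `weak.linter.dupNamespace`).
set_option linter.dupNamespace false

namespace Summit.FinalStateConjecture.FinalStateConjecture.Theorems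

open Set Literature.Geometry.Lorentzian Literature.Geometry.Lorentzian.MetricCoord
open scoped Manifold ContDiff Topology ENNReal

/-- The arithmetic of the constant `ε₁` in (po3.2): for `ν > 0` and any real `B`, the number
`ε₁ := min (ν/4) (ν² / (8 (|B| + 1)))` satisfies `ε₁² ≤ ν²/16` and `ε₁ (|B| + 1) ≤ ν²/8`, whence
`ε₁² ≤ A² − ε H` as soon as `ν/2 ≤ A`, `|H| ≤ B + 1` and `0 < ε ≤ ε₁`. -/
private theorem noncharacteristicOf_margin {ν B A H ε : ℝ} (hν : 0 < ν) (hA : ν / 2 ≤ A)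
    (hH : |H| ≤ B + 1) (hε : 0 < ε) (hεle : ε ≤ min (ν / 4) (ν ^ 2 / (8 * (|B| + 1)))) :
    min (ν / 4) (ν ^ 2 / (8 * (|B| + 1))) ^ 2 ≤ A ^ 2 - ε * H := by
  set ε₁ := min (ν / 4) (ν ^ 2 / (8 * (|B| + 1))) with hε₁def
  have hc : 0 < |B| + 1 := by positivity
  have hε₁pos : 0 < ε₁ := lt_min (by positivity) (by positivity)
  have h1 : ε₁ ≤ ν / 4 := min_le_left _ _
  have h2 : ε₁ ≤ ν ^ 2 / (8 * (|B| + 1)) := min_le_right _ _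
  have hsq : ε₁ ^ 2 ≤ (ν / 4) ^ 2 := pow_le_pow_left₀ hε₁pos.le h1 2
  have hlin : ε₁ * (|B| + 1) ≤ ν ^ 2 / 8 := by
    calc ε₁ * (|B| + 1) ≤ ν ^ 2 / (8 * (|B| + 1)) * (|B| + 1) :=
          mul_le_mul_of_nonneg_right h2 hc.le
      _ = ν ^ 2 / 8 := by field_simp
  have hA2 : (ν / 2) ^ 2 ≤ A ^ 2 := pow_le_pow_left₀ (by positivity) hA 2
  have hHle : H ≤ |B| + 1 := (le_abs_self H).trans (hH.trans (by linarith [le_abs_self B]))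
  have hεH : ε * H ≤ ε₁ * (|B| + 1) :=
    (mul_le_mul_of_nonneg_left hHle hε.le).trans (mul_le_mul_of_nonneg_right hεle hc.le)
  nlinarith [hsq, hlin, hA2, hεH, sq_nonneg ν]

/-- **(P-5) The glue `(P-3) → (P-4) →` time-uniform condition (po3.2) of Ionescu–Klainerman's
Definition 3.1 for `h = r` on every Kerr band beyond the horizon.** From the exact-Kerr
non-characteristic bounds `dr(∇r) ≥ ν > 0`, `|Hess r(∇r, ∇r)| ≤ B` on the band `r_lo ≤ r ≤ r_e`
(hypothesis (P-3)) and their `C¹`-stability over compact sets (hypothesis (P-4)), applied on the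
compact time slice `{x⁰ = 0, r_lo ≤ r ≤ r_e}` with `G₀ = g_{M,a}`, `f = r`: there are `δ > 0` and
`ε₁ > 0` (any `ε₁ > 0` with `ε₁² + ε₁ (|B| + 1) ≤ ν²/4`) such that for every spacetime chart `Φ`
on the exterior region `{M < r}` whose pulled-back components are `δ`-close to `g_{M,a}` in `C²`
sup norm on the band, `(g⁻¹(dr,dr))² − ε Hess r(∇r, ∇r) ≥ ε₁²` for all `0 < ε ≤ ε₁` at every
band point and every time — a band point `z` at time `t = z⁰` is translated to the slice
(`z = z' + t ∂₀`), the components are translated along (`y ↦ (Φ^* g)(y + t ∂₀)`), and Kerr is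
stationary, so the `1`-jets at `z'` of the translated components relative to `g_{M,a}` are those
at `z`, bounded by the sup norm, while `♯`, `dr` and the Hessian are natural under translations;
finally `ν/2 ≤ A` and `|H| ≤ B + 1` give `A² − ε H ≥ ν²/4 − ε₁ (|B| + 1) ≥ ε₁²`. -/
theorem stub_kerrNoncharacteristic_of :
    (∀ (M a r_lo r_e : ℝ), 0 < M → |a| < M → Kerr.rPlus M a < r_lo → r_lo < r_e →
      ∃ (ν B : ℝ), 0 < ν ∧ ∀ z : E4, r_lo ≤ Kerr.radius a z → Kerr.radius a z ≤ r_e →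
        ν ≤ fderiv ℝ (Kerr.radius a) z
            (sharpAt (Kerr.bilin M a) z (fderiv ℝ (Kerr.radius a) z)) ∧
        |hessAt (Kerr.bilin M a) (Kerr.radius a) z
            (sharpAt (Kerr.bilin M a) z (fderiv ℝ (Kerr.radius a) z))
            (sharpAt (Kerr.bilin M a) z (fderiv ℝ (Kerr.radius a) z))| ≤ B) →
    (∀ (G₀ : E4 → E4 →L[ℝ] E4 →L[ℝ] ℝ) (f : E4 → ℝ) (S : Set E4) (ν B : ℝ),
      IsCompact S → 0 < ν →
      (∃ U : Set E4, IsOpen U ∧ S ⊆ U ∧ ContDiffOn ℝ 1 G₀ U ∧ ContDiffOn ℝ 2 f U) →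
      (∀ x ∈ S, (G₀ x).IsInvertible) →
      (∀ x ∈ S, ν ≤ fderiv ℝ f x (sharpAt G₀ x (fderiv ℝ f x)) ∧
        |hessAt G₀ f x (sharpAt G₀ x (fderiv ℝ f x)) (sharpAt G₀ x (fderiv ℝ f x))| ≤ B) →
      ∃ δ : ℝ, 0 < δ ∧ ∀ x ∈ S, ∀ (G : E4 → E4 →L[ℝ] E4 →L[ℝ] ℝ),
        ‖G x - G₀ x‖ ≤ δ → ‖fderiv ℝ G x - fderiv ℝ G₀ x‖ ≤ δ →
        ν / 2 ≤ fderiv ℝ f x (sharpAt G x (fderiv ℝ f x)) ∧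
        |hessAt G f x (sharpAt G x (fderiv ℝ f x)) (sharpAt G x (fderiv ℝ f x))| ≤ B + 1) →
    (∀ (M a r_lo r_e : ℝ), 0 < M → |a| < M → Kerr.rPlus M a < r_lo → r_lo < r_e →
      ∃ (δ ε₁ : ℝ), 0 < δ ∧ 0 < ε₁ ∧
      ∀ (𝓢 : Spacetime.{0} 4) (Φ : E4 → 𝓢.carrier),
        ContMDiffOn 𝓘(ℝ, E4) (𝓡 4) ∞ Φ {z | M < Kerr.radius a z} →
        Topology.IsOpenEmbedding ({z : E4 | M < Kerr.radius a z}.restrict Φ) →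
        supCkENorm {z | M < Kerr.radius a z ∧ r_lo ≤ Kerr.radius a z ∧ Kerr.radius a z ≤ r_e} 2
            (fun z => 𝓢.metricInCoords Φ z - Kerr.bilin M a z) ≤ ENNReal.ofReal δ →
        ∀ z : E4, r_lo ≤ Kerr.radius a z → Kerr.radius a z ≤ r_e →
        ∀ ε : ℝ, 0 < ε → ε ≤ ε₁ →
          ε₁ ^ 2 ≤ (fderiv ℝ (Kerr.radius a) z
              (sharpAt (𝓢.metricInCoords Φ) z (fderiv ℝ (Kerr.radius a) z))) ^ 2
            - ε * hessAt (𝓢.metricInCoords Φ) (Kerr.radius a) z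
              (sharpAt (𝓢.metricInCoords Φ) z (fderiv ℝ (Kerr.radius a) z))
              (sharpAt (𝓢.metricInCoords Φ) z (fderiv ℝ (Kerr.radius a) z))) := by
  intro hP3 hP4 M a r_lo r_e hM ha hlo hloe
  obtain ⟨ν, B, hν, hbounds⟩ := hP3 M a r_lo r_e hM ha hlo hloe
  -- the radius is positive on the band: `r ≥ r_lo > r₊ ≥ M > 0`
  have hrPlus : M ≤ Kerr.rPlus M a := le_add_of_nonneg_right (Real.sqrt_nonneg _)
  have hMlo : M < r_lo := hrPlus.trans_lt hlo
  have hlo0 : 0 < r_lo := hM.trans hMlo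
  -- the compact time slice of the band, inside the open set `{r > 0}`
  set S : Set E4 := {z | z 0 = 0 ∧ r_lo ≤ Kerr.radius a z ∧ Kerr.radius a z ≤ r_e} with hSdef
  have hS : IsCompact S := kerrCylindersBendInward_isCompact_slice a r_e hlo0
  have hSpos : ∀ z ∈ S, 0 < Kerr.radius a z := fun z hz ↦ hlo0.trans_le hz.2.1
  have hU : ∃ U : Set E4, IsOpen U ∧ S ⊆ U ∧ ContDiffOn ℝ 1 (Kerr.bilin M a) U ∧
      ContDiffOn ℝ 2 (Kerr.radius a) U :=
    ⟨{z | 0 < Kerr.radius a z}, isOpen_lt continuous_const (Kerr.continuous_radius a), hSpos,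
      fun z hz ↦ (Kerr.contDiffAt_bilin M a hz).contDiffWithinAt,
      fun z hz ↦ (Kerr.contDiffAt_radius hz).contDiffWithinAt⟩
  have hinv : ∀ z ∈ S, (Kerr.bilin M a z).IsInvertible := fun z hz ↦
    isInvertible_of_nondegenerate fun v hv ↦ Kerr.bilin_nondegenerate M a (hSpos z hz) v hv
  have hboundsS : ∀ z ∈ S,
      ν ≤ fderiv ℝ (Kerr.radius a) z (sharpAt (Kerr.bilin M a) z (fderiv ℝ (Kerr.radius a) z)) ∧
      |hessAt (Kerr.bilin M a) (Kerr.radius a) z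
          (sharpAt (Kerr.bilin M a) z (fderiv ℝ (Kerr.radius a) z))
          (sharpAt (Kerr.bilin M a) z (fderiv ℝ (Kerr.radius a) z))| ≤ B :=
    fun z hz ↦ hbounds z hz.2.1 hz.2.2
  obtain ⟨δ, hδ, hstab⟩ := hP4 (Kerr.bilin M a) (Kerr.radius a) S ν B hS hν hU hinv hboundsS
  -- the constants: `δ` of (P-4) and `ε₁ := min (ν/4) (ν²/(8(|B|+1)))`
  refine ⟨δ, min (ν / 4) (ν ^ 2 / (8 * (|B| + 1))), hδ, lt_min (by positivity) (by positivity),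
    ?_⟩
  intro 𝓢 Φ hΦ _ hsup z hzlo hze ε hε hεle
  -- smoothness of the pulled-back components on the open exterior region, and of `g_{M,a}`
  have hO : IsOpen {z : E4 | M < Kerr.radius a z} :=
    isOpen_lt continuous_const (Kerr.continuous_radius a)
  have hz : z ∈ {z : E4 | M < Kerr.radius a z} := hMlo.trans_le hzlo
  have hGdiff : DifferentiableAt ℝ (𝓢.metricInCoords Φ) z :=
    (((𝓢.contDiffOn_metricInCoords hO hΦ) z hz).contDiffAt (hO.mem_nhds hz)).differentiableAt
      (by simp)
  have hzpos : 0 < Kerr.radius a z := hlo0.trans_le hzlo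
  have hKdiff : DifferentiableAt ℝ (Kerr.bilin M a) z :=
    (Kerr.contDiffAt_bilin M a hzpos (n := 1)).differentiableAt one_ne_zero
  -- pointwise `C¹`-closeness at `z` from the `C²` sup norm over the band
  have hzK : z ∈ {z : E4 | M < Kerr.radius a z ∧
      r_lo ≤ Kerr.radius a z ∧ Kerr.radius a z ≤ r_e} := ⟨hz, hzlo, hze⟩
  have hjet : ∀ k ≤ 2,
      ‖iteratedFDeriv ℝ k (fun z ↦ 𝓢.metricInCoords Φ z - Kerr.bilin M a z) z‖ ≤ δ := by
    intro k hk
    have h := (enorm_iteratedFDeriv_le_supCkENorm hk hzK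
      (fun z ↦ 𝓢.metricInCoords Φ z - Kerr.bilin M a z)).trans hsup
    rwa [← ofReal_norm, ENNReal.ofReal_le_ofReal_iff hδ.le] at h
  have hd0 : ‖𝓢.metricInCoords Φ z - Kerr.bilin M a z‖ ≤ δ := by
    have h := hjet 0 (by norm_num)
    rwa [norm_iteratedFDeriv_zero] at h
  have hd1 : ‖fderiv ℝ (𝓢.metricInCoords Φ) z - fderiv ℝ (Kerr.bilin M a) z‖ ≤ δ := by
    have h := hjet 1 (by norm_num)
    rwa [norm_iteratedFDeriv_one, fderiv_fun_sub hGdiff hKdiff] at h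
  -- translate `z` to the time slice: `z = z' + t ∂₀`, `t = z⁰`
  obtain ⟨t, ht⟩ : ∃ t : ℝ, z 0 = t := ⟨_, rfl⟩
  obtain ⟨z', hz'z⟩ : ∃ z' : E4, z' + t • E4.basisVector 0 = z :=
    ⟨z - t • E4.basisVector 0, sub_add_cancel z _⟩
  have hz'0 : z' 0 = 0 := by
    have h : (z' + t • E4.basisVector 0) 0 = z 0 := by rw [hz'z]
    rw [ht] at h
    simpa [E4.basisVector] using h
  -- stationarity of Kerr: the radius, the components and their first derivatives agree
  have hradfun : (fun y : E4 ↦ Kerr.radius a (y + t • E4.basisVector 0)) = Kerr.radius a :=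
    funext fun y ↦ Kerr.radius_add_time_smul_basisVector a y t
  have hbilfun : (fun y : E4 ↦ Kerr.bilin M a (y + t • E4.basisVector 0)) = Kerr.bilin M a :=
    funext fun y ↦ Kerr.bilin_add_smul_basisVector_zero M a y t
  have hrad' : Kerr.radius a z' = Kerr.radius a z := by
    rw [← hz'z, Kerr.radius_add_time_smul_basisVector]
  have hbil' : Kerr.bilin M a z' = Kerr.bilin M a z := by
    rw [← hz'z, Kerr.bilin_add_smul_basisVector_zero]
  have hfdrad' : fderiv ℝ (Kerr.radius a) z' = fderiv ℝ (Kerr.radius a) z := by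
    rw [← hz'z, ← fderiv_comp_add_right (t • E4.basisVector 0)]
    exact (congrArg (fun g : E4 → ℝ ↦ fderiv ℝ g z') hradfun).symm
  have hfdbil' : fderiv ℝ (Kerr.bilin M a) z' = fderiv ℝ (Kerr.bilin M a) z := by
    rw [← hz'z, ← fderiv_comp_add_right (t • E4.basisVector 0)]
    exact (congrArg (fun g : E4 → E4 →L[ℝ] E4 →L[ℝ] ℝ ↦ fderiv ℝ g z') hbilfun).symm
  have hz'S : z' ∈ S := by
    rw [hSdef]
    exact ⟨hz'0, hzlo.trans_eq hrad'.symm, hrad'.trans_le hze⟩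
  -- the translated components `y ↦ (Φ^* g)(y + t ∂₀)`: their `1`-jet at `z'`, and the naturality
  -- of `♯` and of the Hessian
  have hGt1 : fderiv ℝ (fun y ↦ 𝓢.metricInCoords Φ (y + t • E4.basisVector 0)) z' =
      fderiv ℝ (𝓢.metricInCoords Φ) z := by
    rw [fderiv_comp_add_right, hz'z]
  have hsharp : sharpAt (fun y ↦ 𝓢.metricInCoords Φ (y + t • E4.basisVector 0)) z' =
      sharpAt (𝓢.metricInCoords Φ) z := by
    rw [sharpAt_comp_add_right, hz'z]
  have hH : hessAt (fun y ↦ 𝓢.metricInCoords Φ (y + t • E4.basisVector 0)) (Kerr.radius a) z' =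
      hessAt (𝓢.metricInCoords Φ) (Kerr.radius a) z := by
    have h := kerrCylindersBendInward_hessAt_comp_add_right (𝓢.metricInCoords Φ) (Kerr.radius a)
      (t • E4.basisVector 0) z'
    rw [hradfun, hz'z] at h
    exact h
  -- (P-4) at `x = z'`, `G =` the translated components
  have key := hstab z' hz'S (fun y ↦ 𝓢.metricInCoords Φ (y + t • E4.basisVector 0))
    (by
      show ‖𝓢.metricInCoords Φ (z' + t • E4.basisVector 0) - Kerr.bilin M a z'‖ ≤ δ
      rw [hz'z, hbil']
      exact hd0)
    (by
      rw [hGt1, hfdbil']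
      exact hd1)
  rw [hsharp, hfdrad', hH] at key
  -- the arithmetic `ν/2 ≤ A`, `|H| ≤ B + 1`, `0 < ε ≤ ε₁` `⇒` `ε₁² ≤ A² − ε H`
  exact noncharacteristicOf_margin hν key.1 key.2 hε hεle

end Summit.FinalStateConjecture.FinalStateConjecture.Theorems

end
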